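import Mathlib
import Summits.Parity.BatemanHorn.Theses.PolynomialMobius

/-!
# Strategy census gen 4 — typed companion (crux stmt-Parity-0870 `PolyMobiusTail`)

Crux-strategist `planner-cstrat-stmt-Parity-0870-s1-0`, 2026-08-17.  Signatures of the NEW pieces
censused in `STRATEGY-CENSUS.md` (gen 4): S12 (`CyclicKloostermanBalanced`, the exponential-sum
strengthening of the `k = 3` balanced window), D19 (`GYMixedLinear` / `SharpPiecesLinear`, the
per-coordinate Goldston–Yıldırım anatomy for all-linear systems) and D20 (`CoreComplete` /
`HyperIncompleteBand`, the split of the live line's `stub_large` at the pencil-completeness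
threshold).  Nothing here is proved or registered; the file only certifies that the signatures
elaborate (the census verdict for each is "no leverage", see the markdown).  No `sorry`.
-/

open scoped BigOperators
open Filter Finset Asymptotics

namespace Summit.Parity.BatemanHorn.Cruxes.PolyMobiusTail.StrategyCensusGen4

open Literature.NumberTheory.Sieve

/-- `Λ♭_y(m) = -∑_{d ∣ m, d ≤ y} μ(d) log d` — the divisor-side ("Type I") truncation of
`Λ = -(μ·log) ∗ 1` at level `y` in ONE coordinate. -/
noncomputable def lambdaFlat (y : ℝ) (m : ℕ) : ℝ :=
  - ∑ d ∈ m.divisors, if (d : ℝ) ≤ y then (ArithmeticFunction.moebius d : ℝ) * Real.log d else 0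

/-- `Λ♯_y = Λ - Λ♭_y = -∑_{d ∣ m, d > y} μ(d) log d = -∑_{e ∣ m, e < m/y} μ(m/e) log(m/e)`. -/
noncomputable def lambdaSharp (y : ℝ) (m : ℕ) : ℝ :=
  ArithmeticFunction.vonMangoldt m - lambdaFlat y m

/-- **D19, piece A (theorem-grade in print: Goldston–Yıldırım 2003 Thm 1.3, via Bombieri–Vinogradov).**
For a Bateman–Horn system of `k+1` LINEAR members, the mixed correlation with ONE von Mangoldt factor
kept whole and the other `k` members truncated at level `y = x^c`, `c·k < 1/2`, has the full
Bateman–Horn/Hardy–Littlewood main term `C(f)·x`. -/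
def GYMixedLinear : Prop :=
  ∀ (k : ℕ) (f : Fin (k + 1) → Polynomial ℤ), IsBatemanHornSystem f →
    (∀ i, (f i).natDegree ≤ 1) → ∀ c : ℝ, 0 < c → c * k < 1 / 2 →
      ∃ C : ℝ, 0 < C ∧ HasBatemanHornConst f C ∧
        Asymptotics.IsEquivalent atTop
          (fun x : ℕ => ∑ n ∈ Finset.Icc 1 x,
            ArithmeticFunction.vonMangoldt (((f 0).eval (n : ℤ)).toNat) *
              ∏ i : Fin k, lambdaFlat ((x : ℝ) ^ c) (((f i.succ).eval (n : ℤ)).toNat))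
          (fun x : ℕ => C * (x : ℝ))

/-- **D19, piece B (the ♯-pieces = parity cores along cofactor pencils, all-linear systems).**
The difference between the full `Λ`-correlation and the all-flat mixed correlation — the sum over
the `2^k - 1` terms carrying at least one `Λ♯` factor — is `o(x)` for some admissible `c`. -/
def SharpPiecesLinear : Prop :=
  ∀ (k : ℕ) (f : Fin (k + 1) → Polynomial ℤ), IsBatemanHornSystem f →
    (∀ i, (f i).natDegree ≤ 1) →
      ∃ c : ℝ, 0 < c ∧ c * k < 1 / 2 ∧
        (fun x : ℕ => ∑ n ∈ Finset.Icc 1 x,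
            ArithmeticFunction.vonMangoldt (((f 0).eval (n : ℤ)).toNat) *
              (∏ i : Fin k, ArithmeticFunction.vonMangoldt (((f i.succ).eval (n : ℤ)).toNat) -
               ∏ i : Fin k, lambdaFlat ((x : ℝ) ^ c) (((f i.succ).eval (n : ℤ)).toNat)))
          =o[atTop] fun x : ℕ => (x : ℝ)

/-- **S12 (strengthening of `stub_window_linear_three_le` at its stuck shape).** A power saving for
the CYCLIC trilinear Kloosterman-fraction sum at the balanced point: three variables of the same
size `N`, arbitrary bounded coefficients, phase `e(A·\overline{bc}/a + B·\overline{ac}/b)` with small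
non-zero numerators.  (The `k = 3` window phase after CRT; no bound of this shape is in print —
Bettin–Chandee / Wright have the numerator as a FREE third variable.) -/
def CyclicKloostermanBalanced : Prop :=
  ∃ δ : ℝ, 0 < δ ∧ ∃ K : ℝ, ∀ N : ℝ, 2 ≤ N → ∀ A B : ℤ, A ≠ 0 → B ≠ 0 →
    (|A| : ℝ) ≤ N ^ δ → (|B| : ℝ) ≤ N ^ δ →
    ∀ α β γ : ℕ → ℂ, (∀ n, ‖α n‖ ≤ 1) → (∀ n, ‖β n‖ ≤ 1) → (∀ n, ‖γ n‖ ≤ 1) →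
      ‖∑ a ∈ Finset.Ioc ⌊N⌋₊ ⌊2 * N⌋₊, ∑ b ∈ Finset.Ioc ⌊N⌋₊ ⌊2 * N⌋₊, ∑ c ∈ Finset.Ioc ⌊N⌋₊ ⌊2 * N⌋₊,
          if a.Coprime b ∧ b.Coprime c ∧ a.Coprime c then
            α a * β b * γ c *
              Complex.exp (2 * Real.pi * Complex.I *
                ((A : ℂ) * ((((b * c : ℕ) : ZMod a)⁻¹).val : ℂ) / (a : ℂ) +
                 (B : ℂ) * ((((a * c : ℕ) : ZMod b)⁻¹).val : ℂ) / (b : ℂ)))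
          else 0‖ ≤ K * N ^ (3 - δ)

/-- **D20, piece 1: the pencil-COMPLETE part of the live line's `stub_large`** (cofactor tuples with
`∏ eᵢ ≤ x^{1-δ}`, so every pencil `n ≡ r (mod ∏eᵢ)` has `≥ x^δ` terms): the parity core proper. -/
def CoreComplete : Prop :=
  ∀ (k : ℕ) (f : Fin k → Polynomial ℤ), IsBatemanHornSystem f → ∀ θ δ : ℝ, 0 < θ → θ < 1 → 0 < δ → δ < 1 →
    (fun x : ℕ => ∑ n ∈ Finset.Icc 1 x,
      ∑ e ∈ Fintype.piFinset (fun i => (((f i).eval (n : ℤ)).toNat).divisors),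
        if (x : ℝ) ^ (1 + θ) < ∏ i, ((((f i).eval (n : ℤ)).toNat / e i : ℕ) : ℝ) ∧
            ∏ i, (e i : ℝ) ≤ (x : ℝ) ^ (1 - δ) then
          ∏ i, ((ArithmeticFunction.moebius (((f i).eval (n : ℤ)).toNat / e i) : ℝ) *
            Real.log ((((f i).eval (n : ℤ)).toNat / e i : ℕ) : ℝ)) else 0)
      =o[atTop] fun x : ℕ => (x : ℝ)

/-- **D20, piece 2: the HYPER-INCOMPLETE band of `stub_large`** (both the divisor product `∏dᵢ` and the
cofactor product `∏eᵢ` exceed `x^{1∓…}`; empty for total degree `G ≤ 2` once `δ < θ`, of full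
measure for `G ≥ 3`): open even with all `μ` replaced by `1` (triple divisor correlations). -/
def HyperIncompleteBand : Prop :=
  ∀ (k : ℕ) (f : Fin k → Polynomial ℤ), IsBatemanHornSystem f → ∀ θ δ : ℝ, 0 < θ → θ < 1 → 0 < δ → δ < 1 →
    (fun x : ℕ => ∑ n ∈ Finset.Icc 1 x,
      ∑ e ∈ Fintype.piFinset (fun i => (((f i).eval (n : ℤ)).toNat).divisors),
        if (x : ℝ) ^ (1 + θ) < ∏ i, ((((f i).eval (n : ℤ)).toNat / e i : ℕ) : ℝ) ∧
            (x : ℝ) ^ (1 - δ) < ∏ i, (e i : ℝ) then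
          ∏ i, ((ArithmeticFunction.moebius (((f i).eval (n : ℤ)).toNat / e i) : ℝ) *
            Real.log ((((f i).eval (n : ℤ)).toNat / e i : ℕ) : ℝ)) else 0)
      =o[atTop] fun x : ℕ => (x : ℝ)

/-- The live line's `stub_large` statement (verbatim signature), for the glue below. -/
def LargeAll : Prop :=
  ∀ (k : ℕ) (f : Fin k → Polynomial ℤ), IsBatemanHornSystem f → ∀ θ : ℝ, 0 < θ → θ < 1 →
    (fun x : ℕ => ∑ n ∈ Finset.Icc 1 x,
      ∑ e ∈ Fintype.piFinset (fun i => (((f i).eval (n : ℤ)).toNat).divisors),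
        if (x : ℝ) ^ (1 + θ) < ∏ i, ((((f i).eval (n : ℤ)).toNat / e i : ℕ) : ℝ) then
          ∏ i, ((ArithmeticFunction.moebius (((f i).eval (n : ℤ)).toNat / e i) : ℝ) *
            Real.log ((((f i).eval (n : ℤ)).toNat / e i : ℕ) : ℝ)) else 0)
      =o[atTop] fun x : ℕ => (x : ℝ)

/-- **D20 glue (PROVED, and trivial — which is the census point):** the two pieces give `stub_large`
by an additive range split at `∏eᵢ ≤ x^{1-δ}` (any fixed `δ`, here `δ = 1/2`). -/
theorem largeAll_of_core_band (hC : CoreComplete) (hB : HyperIncompleteBand) : LargeAll := by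
  intro k f hf θ hθ0 hθ1
  have h1 := hC k f hf θ (1 / 2) hθ0 hθ1 (by norm_num) (by norm_num)
  have h2 := hB k f hf θ (1 / 2) hθ0 hθ1 (by norm_num) (by norm_num)
  refine (h1.add h2).congr_left fun x => ?_
  rw [← Finset.sum_add_distrib]
  refine Finset.sum_congr rfl fun n _ => ?_
  rw [← Finset.sum_add_distrib]
  refine Finset.sum_congr rfl fun e _ => ?_
  by_cases hA : (x : ℝ) ^ (1 + θ) < ∏ i, ((((f i).eval (n : ℤ)).toNat / e i : ℕ) : ℝ)
  · by_cases hle : ∏ i, (e i : ℝ) ≤ (x : ℝ) ^ (1 - (1 / 2 : ℝ))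
    · rw [if_pos hA, if_pos ⟨hA, hle⟩, if_neg (fun h => (not_lt.mpr hle) h.2), add_zero]
    · rw [if_pos hA, if_neg (fun h => hle h.2), if_pos ⟨hA, not_le.mp hle⟩, zero_add]
  · rw [if_neg hA, if_neg (fun h => hA h.1), if_neg (fun h => hA h.1), add_zero]

end Summit.Parity.BatemanHorn.Cruxes.PolyMobiusTail.StrategyCensusGen4
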